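import Literature.Geometry.GeometricMeasureTheory.CubicalPolyhedral
import Literature.Geometry.GeometricMeasureTheory.MassFormula
import Mathlib.Analysis.Normed.Lp.MeasurableSpace
import HarnessLib

/-!
# Face charts: a rectifiable current carried by the cubical skeleton as a sum of flat chart
# currents with `L¹` integer densities

Support file for the boundary-rectifiability theorem [Federer1969, 4.2.16 (2)] (slicing of the
cubical retraction of a rectifiable current, White's route [White1989, p. 210]). A rectifiable
current `Q ∈ 𝓡_{k}(V)` supported in the scaled `k`-skeleton `μ_ε W'_k` of the cubical subdivision
(`CubicalModel.lean`) charges only the open `k`-faces (the `(k-1)`-skeleton is `𝓗ᵏ`-null), the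
faces are flat, and on a flat piece the orienting frame of admissible data is `±` the frame of
the face (`IsRectifiableData.ae_frameVector_eq_or`); transporting `𝓗ᵏ ⌞ (p + P₀)` to Lebesgue
measure on `ℝᵏ` along the isometric affine chart `u ↦ p + Σ u_l e_l` of the face
(`Isometry.map_euclideanHausdorffMeasure`) yields:

* `hasFDerivAt_affineFrameChart`, `lipschitzWith_frameCoordinates`, `isometry_euclideanFrameChart`,
  `map_volume_affineFrameChart` — calculus and measure theory of the chart `u ↦ p + Σ u_l e_l`
  of an orthonormal frame `e` (derivative `v ↦ Σ v_l e_l`, injective; `1`-Lipschitz left inverse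
  `y ↦ (⟪e_l, y − p⟫)_l`; `Ψ_* ℒᵏ = 𝓗ᵏ ⌞ (p + span e)`), with the transport of integrals,
  integrability and null sets `setIntegral_euclideanHausdorff_eq_integral_affineFrameChart`,
  `integrableOn_affineFrameChart_iff`, `ae_affineFrameChart_of_ae`;
* **`Current.IsRectifiable.exists_faceCharts`** — for `Q ∈ 𝓡_{j+1}(V)` with
  `spt Q ⊆ μ_ε W'_{j+1}` there are finitely many faces `z ∈ F` with points `p_z`, orthonormal
  frames `e_z`, bounded measurable `C_z ⊆ ℝ^{j+1}` and integrable densities `θ_z : ℝ^{j+1} → ℤ`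
  such that `Q(ψ) = Σ_{z ∈ F} ∫_{C_z} θ_z(u) ψ(p_z + Σ u_l e_{z,l})(e_z) du` for every test form
  `ψ` [Federer1969, 4.1.28, 4.2.9: the structure of `(σ ∘ τ_a)_# T` on the top faces, here without
  the constancy theorem since `∂Q` is not controlled].

Theorems only; no definitions, no named facts.

## References

* H. Federer, *Geometric Measure Theory*, Springer 1969, 1.7.1, 2.10.10, 3.2.3, 4.1.28, 4.2.5,
  4.2.9 [Federer1969].
* M. Spivak, *Calculus on Manifolds*, Benjamin 1965, Thm. 2-3 [Spivak1965].
* B. White, *A new proof of the compactness theorem for integral currents*, Comment. Math. Helv.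
  64 (1989) 207–220 [White1989].
-/

noncomputable section

open scoped ENNReal NNReal Topology ContDiff InnerProductSpace RealInnerProductSpace
open MeasureTheory TopologicalSpace Set Filter Metric Function Module WithLp

namespace Literature.Geometry.GeometricMeasureTheory

set_option maxSynthPendingDepth 2

/-! ### The affine chart of an orthonormal frame -/

section Chart

variable {V : Type*} [NormedAddCommGroup V] [InnerProductSpace ℝ V] {k : ℕ}

/-- The norm of a combination of an orthonormal frame: `‖Σ c_l e_l‖ = (Σ c_l²)^{1/2}`. [folklore] -/
private theorem norm_sum_smul_orthonormal {e : Fin k → V} (he : Orthonormal ℝ e) (c : Fin k → ℝ) :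
    ‖∑ l, c l • e l‖ = Real.sqrt (∑ l, c l ^ 2) := by
  rw [norm_eq_sqrt_real_inner, he.inner_sum]
  congr 1
  exact Finset.sum_congr rfl fun l _ => by rw [conj_trivial, sq]

/-- **The differential of the affine frame chart** `u ↦ p + Σ u_l e_l` is the linear map
`v ↦ Σ v_l e_l` (at every point: an affine map is differentiable with differential its linear
part). [cite: Spivak1965, Thm. 2-3] -/
theorem hasFDerivAt_affineFrameChart (p : V) (e : Fin k → V) (u : Fin k → ℝ) :
    HasFDerivAt (fun u : Fin k → ℝ => p + ∑ l, u l • e l)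
      (∑ l, (ContinuousLinearMap.proj l : (Fin k → ℝ) →L[ℝ] ℝ).smulRight (e l)) u := by
  have h : (fun u : Fin k → ℝ => p + ∑ l, u l • e l) = fun u =>
      p + (∑ l, (ContinuousLinearMap.proj l : (Fin k → ℝ) →L[ℝ] ℝ).smulRight (e l)) u := by
    funext u
    simp [ContinuousLinearMap.smulRight_apply]
  rw [h]
  exact (ContinuousLinearMap.hasFDerivAt _).const_add p

/-- The derivative of the affine frame chart sends `e'_l` to `e_l`. [cite: Spivak1965, Thm. 2-3] -/
theorem fderiv_affineFrameChart_single (p : V) (e : Fin k → V) (u : Fin k → ℝ) (l : Fin k) :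
    fderiv ℝ (fun u : Fin k → ℝ => p + ∑ l, u l • e l) u (Pi.single l 1) = e l := by
  rw [(hasFDerivAt_affineFrameChart p e u).fderiv]
  simp [ContinuousLinearMap.smulRight_apply, Pi.single_apply]

/-- The frame of the affine frame chart: `(DΨ(u) e'_0, …) = e`. [cite: Spivak1965, Thm. 2-3] -/
theorem fderiv_affineFrameChart_frame (p : V) (e : Fin k → V) (u : Fin k → ℝ) :
    (fun l => fderiv ℝ (fun u : Fin k → ℝ => p + ∑ l, u l • e l) u (Pi.single l 1)) = e :=
  funext (fderiv_affineFrameChart_single p e u)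

/-- The affine frame chart is smooth (affine maps are `C^∞`). [cite: Spivak1965, Thm. 2-3] -/
theorem contDiff_affineFrameChart (p : V) (e : Fin k → V) :
    ContDiff ℝ ∞ (fun u : Fin k → ℝ => p + ∑ l, u l • e l) :=
  contDiff_const.add (ContDiff.sum fun l _ => (contDiff_apply ℝ ℝ l).smul contDiff_const)

/-- For an orthonormal frame the differential `v ↦ Σ v_l e_l` of the chart is injective
(`⟪e_i, Σ v_l e_l⟫ = v_i`). [cite: Federer1969, 1.7.1; Spivak1965, Thm. 2-3] -/
theorem injective_fderiv_affineFrameChart (p : V) {e : Fin k → V} (he : Orthonormal ℝ e)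
    (u : Fin k → ℝ) : Injective (fderiv ℝ (fun u : Fin k → ℝ => p + ∑ l, u l • e l) u) := by
  rw [(hasFDerivAt_affineFrameChart p e u).fderiv]
  intro v w hvw
  funext i
  have h : ∀ v : Fin k → ℝ, (∑ l, (ContinuousLinearMap.proj l : (Fin k → ℝ) →L[ℝ] ℝ).smulRight
      (e l)) v = ∑ l, v l • e l := fun v => by
    simp [ContinuousLinearMap.smulRight_apply]
  have := congrArg (fun y => ⟪e i, y⟫) hvw
  simpa only [h, he.inner_right_fintype] using this

/-- **The frame coordinates `y ↦ (⟪e_l, y − p⟫)_l` are `1`-Lipschitz** (into `ℝᵏ` with the sup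
norm: `|⟪e_l, y − y'⟫| ≤ |y − y'|`). [cite: Federer1969, 1.7.1] -/
theorem lipschitzWith_frameCoordinates (p : V) {e : Fin k → V} (he : Orthonormal ℝ e) :
    LipschitzWith 1 (fun y : V => fun l => ⟪e l, y - p⟫) := by
  refine LipschitzWith.of_dist_le_mul fun y y' => ?_
  rw [NNReal.coe_one, one_mul]
  refine (dist_pi_le_iff dist_nonneg).2 fun l => ?_
  rw [Real.dist_eq, ← inner_sub_right, sub_sub_sub_cancel_right, dist_eq_norm]
  refine (abs_real_inner_le_norm _ _).trans ?_
  rw [he.1 l, one_mul]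

/-- The frame coordinates invert the chart: `⟪e_l, Ψ(u) − p⟫ = u_l` (orthonormality).
[cite: Federer1969, 1.7.1] -/
theorem frameCoordinates_affineFrameChart (p : V) {e : Fin k → V} (he : Orthonormal ℝ e)
    (u : Fin k → ℝ) : (fun l => ⟪e l, (p + ∑ l, u l • e l) - p⟫) = u := by
  funext l
  rw [add_sub_cancel_left, he.inner_right_fintype]

/-- **The Euclidean frame chart `z ↦ p + Σ z_l e_l` is an isometry** of `EuclideanSpace ℝ (Fin k)`
into `V` (`|Σ c_l e_l|² = Σ c_l²` for an orthonormal frame). [cite: Federer1969, 1.7.1] -/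
theorem isometry_euclideanFrameChart (p : V) {e : Fin k → V} (he : Orthonormal ℝ e) :
    Isometry (fun z : EuclideanSpace ℝ (Fin k) => p + ∑ l, ofLp z l • e l) := by
  refine Isometry.of_dist_eq fun z z' => ?_
  rw [dist_eq_norm, add_sub_add_left_eq_sub, ← Finset.sum_sub_distrib, EuclideanSpace.dist_eq]
  have : ∑ l, (ofLp z l • e l - ofLp z' l • e l) = ∑ l, (ofLp z l - ofLp z' l) • e l :=
    Finset.sum_congr rfl fun l _ => by rw [sub_smul]
  rw [this, norm_sum_smul_orthonormal he]
  congr 1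
  exact Finset.sum_congr rfl fun l _ => by rw [Real.dist_eq, sq_abs]

end Chart

/-! ### Transport of `𝓗ᵏ ⌞ (p + span e)` to Lebesgue measure on `ℝᵏ` -/

section Transport

variable {V : Type*} [NormedAddCommGroup V] [InnerProductSpace ℝ V] [MeasurableSpace V] [BorelSpace V]
  {k : ℕ}

/-- The affine frame chart is a measurable embedding. [folklore] -/
private theorem measurableEmbedding_affineFrameChart (p : V) {e : Fin k → V} (he : Orthonormal ℝ e) :
    MeasurableEmbedding (fun u : Fin k → ℝ => p + ∑ l, u l • e l) := by
  have h1 : MeasurableEmbedding (fun z : EuclideanSpace ℝ (Fin k) => p + ∑ l, ofLp z l • e l) :=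
    (isometry_euclideanFrameChart p he).isClosedEmbedding.measurableEmbedding
  have h2 : MeasurableEmbedding (toLp 2 : (Fin k → ℝ) → EuclideanSpace ℝ (Fin k)) := by
    rw [← MeasurableEquiv.coe_toLp]
    exact (MeasurableEquiv.toLp 2 (Fin k → ℝ)).measurableEmbedding
  have h3 := h1.comp h2
  exact h3

/-- **`Ψ_* ℒᵏ = 𝓗ᵏ ⌞ Ψ(ℝᵏ)`** for the affine chart `Ψ(u) = p + Σ u_l e_l` of an orthonormal frame:
the chart is an isometry of Euclidean `ℝᵏ` onto the affine plane `p + span e`, and `𝓗ᵏ` on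
Euclidean `ℝᵏ` is Lebesgue measure. [cite: Federer1969, 2.10.10, 3.2.3] -/
theorem map_volume_affineFrameChart (p : V) {e : Fin k → V} (he : Orthonormal ℝ e) :
    Measure.map (fun u : Fin k → ℝ => p + ∑ l, u l • e l) volume =
      (μHE[k] : Measure V).restrict (range fun u : Fin k → ℝ => p + ∑ l, u l • e l) := by
  set ι : EuclideanSpace ℝ (Fin k) → V := fun z => p + ∑ l, ofLp z l • e l with hι
  have hιiso : Isometry ι := isometry_euclideanFrameChart p he
  have hcomp : (fun u : Fin k → ℝ => p + ∑ l, u l • e l) = ι ∘ (toLp 2) := by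
    funext u; simp [hι]
  have hsurj : Surjective (toLp 2 : (Fin k → ℝ) → EuclideanSpace ℝ (Fin k)) :=
    fun z => ⟨ofLp z, by simp⟩
  rw [hcomp, ← Measure.map_map hιiso.continuous.measurable (PiLp.volume_preserving_toLp (Fin k)).measurable,
    (PiLp.volume_preserving_toLp (Fin k)).map_eq, ← EuclideanSpace.euclideanHausdorffMeasure_eq_volume,
    hιiso.map_euclideanHausdorffMeasure, hsurj.range_comp]

/-- **Transport of integrals**: for Borel `A ⊆ Ψ(ℝᵏ)`,
`∫_A g d𝓗ᵏ = ∫_{Ψ⁻¹ A} g(Ψ u) du` (area formula for the isometric chart, Jacobian `1`).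
[cite: Federer1969, 3.2.3] -/
theorem setIntegral_euclideanHausdorff_eq_integral_affineFrameChart (p : V) {e : Fin k → V}
    (he : Orthonormal ℝ e) {A : Set V} (hA : MeasurableSet A)
    (hAr : A ⊆ range fun u : Fin k → ℝ => p + ∑ l, u l • e l) (g : V → ℝ) :
    ∫ x in A, g x ∂(μHE[k] : Measure V) =
      ∫ u in (fun u : Fin k → ℝ => p + ∑ l, u l • e l) ⁻¹' A, g (p + ∑ l, u l • e l) := by
  have hres : (μHE[k] : Measure V).restrict A =
      (Measure.map (fun u : Fin k → ℝ => p + ∑ l, u l • e l) volume).restrict A := by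
    rw [map_volume_affineFrameChart p he, Measure.restrict_restrict hA, inter_eq_left.2 hAr]
  rw [show (∫ x in A, g x ∂(μHE[k] : Measure V)) = ∫ x, g x ∂((μHE[k] : Measure V).restrict A)
    from rfl, hres]
  exact (measurableEmbedding_affineFrameChart p he).setIntegral_map g A

/-- Transport of integrability along the chart. [cite: Federer1969, 3.2.3] -/
theorem integrableOn_affineFrameChart_iff (p : V) {e : Fin k → V} (he : Orthonormal ℝ e)
    {A : Set V} (hA : MeasurableSet A) (hAr : A ⊆ range fun u : Fin k → ℝ => p + ∑ l, u l • e l)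
    (g : V → ℝ) :
    IntegrableOn g A (μHE[k] : Measure V) ↔
      IntegrableOn (fun u => g (p + ∑ l, u l • e l))
        ((fun u : Fin k → ℝ => p + ∑ l, u l • e l) ⁻¹' A) := by
  have hres : (μHE[k] : Measure V).restrict A =
      (Measure.map (fun u : Fin k → ℝ => p + ∑ l, u l • e l) volume).restrict A := by
    rw [map_volume_affineFrameChart p he, Measure.restrict_restrict hA, inter_eq_left.2 hAr]
  rw [IntegrableOn, hres]
  exact (measurableEmbedding_affineFrameChart p he).integrableOn_map_iff

/-- Transport of null sets along the chart: an `𝓗ᵏ ⌞ A`-a.e. property holds at `Ψ(u)` for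
a.e. `u ∈ Ψ⁻¹ A`. [cite: Federer1969, 3.2.3] -/
theorem ae_affineFrameChart_of_ae (p : V) {e : Fin k → V} (he : Orthonormal ℝ e) {A : Set V}
    (hA : MeasurableSet A) (hAr : A ⊆ range fun u : Fin k → ℝ => p + ∑ l, u l • e l)
    {P : V → Prop} (h : ∀ᵐ x ∂((μHE[k] : Measure V).restrict A), P x) :
    ∀ᵐ u ∂(volume.restrict ((fun u : Fin k → ℝ => p + ∑ l, u l • e l) ⁻¹' A)),
      P (p + ∑ l, u l • e l) := by
  have hres : (μHE[k] : Measure V).restrict A =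
      (Measure.map (fun u : Fin k → ℝ => p + ∑ l, u l • e l) volume).restrict A := by
    rw [map_volume_affineFrameChart p he, Measure.restrict_restrict hA, inter_eq_left.2 hAr]
  rw [hres, (measurableEmbedding_affineFrameChart p he).restrict_map] at h
  exact (measurableEmbedding_affineFrameChart p he).ae_map_iff.1 h

end Transport

/-! ### The face decomposition of a rectifiable current carried by the skeleton -/

section Faces

open Cubical

variable {V : Type*} [NormedAddCommGroup V] [InnerProductSpace ℝ V] [FiniteDimensional ℝ V]
  [MeasurableSpace V] [BorelSpace V] {n : ℕ}

/-- **Face charts of a rectifiable current carried by the cubical skeleton.** Let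
`Q ∈ 𝓡_{j+1}(V)` with `spt Q ⊆ μ_ε W'_{j+1}`. Then there are finitely many lattice points `z ∈ F`
(the `(j+1)`-faces meeting `spt Q`), and for each an orthonormal frame `e_z` and base point `p_z`
of the affine plane of the face, a bounded Borel set `C_z ⊆ ℝ^{j+1}` and an integrable density
`θ_z : ℝ^{j+1} → ℤ`, such that for every test form `ψ`

  `Q(ψ) = Σ_{z ∈ F} ∫_{C_z} θ_z(u) ψ(p_z + Σ_l u_l e_{z,l})(e_z) du`:

`Q` is the sum of its pieces in the open top faces (`‖Q‖(μ_ε W'_j) = 0`, the `j`-skeleton being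
`𝓗^{j+1}`-null, and the faces are disjoint), each piece is `[W ∩ W'(z), θ, ξ]` with
`ξ = ± e_z` almost everywhere (the approximate tangent planes of a flat rectifiable set lie in the
plane), and `𝓗^{j+1} ⌞ (p_z + P_z)` is Lebesgue measure in the isometric chart.
[cite: Federer1969, 4.1.28, 4.2.9, 3.2.3] -/
theorem Current.IsRectifiable.exists_faceCharts (b : OrthonormalBasis (Fin n) ℝ V) {ε : ℝ}
    (hε : 0 < ε) {j : ℕ} {Q : Current (⊤ : Opens V) (j + 1)} (hQ : Q.IsRectifiable)
    (hsupp : Q.support ⊆ skeletonV b (j + 1) ε) :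
    ∃ (F : Finset (Fin n → ℤ)) (p : (Fin n → ℤ) → V) (e : (Fin n → ℤ) → Fin (j + 1) → V)
      (C : (Fin n → ℤ) → Set (Fin (j + 1) → ℝ)) (θ : (Fin n → ℤ) → (Fin (j + 1) → ℝ) → ℤ),
      (∀ z ∈ F, Orthonormal ℝ (e z)) ∧ (∀ z ∈ F, MeasurableSet (C z)) ∧
      (∀ z ∈ F, Bornology.IsBounded (C z)) ∧
      (∀ z ∈ F, IntegrableOn (fun u => (θ z u : ℝ)) (C z)) ∧
      ∀ ψ : TestForm (⊤ : Opens V) (j + 1),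
        Q ψ = ∑ z ∈ F, ∫ u in C z, (θ z u : ℝ) * ψ (p z + ∑ l, u l • e z l) (e z) := by
  classical
  obtain ⟨W, θ₀, ξ, hd, hQeq, hWK, -, -⟩ := hQ.exists_data_subset hQ.2 Subset.rfl
  have hcpt : IsCompact Q.support := hQ.2
  subst hQeq
  set T : Current (⊤ : Opens V) (j + 1) := currentOfIntegration W θ₀ ξ with hT
  have hTr : T.IsRepresentable := hd.isRepresentable
  have hWm : MeasurableSet W := hd.1
  set μH : Measure V := μHE[j + 1] with hμH
  -- `‖T‖` does not charge the `j`-skeleton nor the complement of the support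
  have hvarW : T.variation = (μH.restrict W).withDensity fun x => ‖(θ₀ x : ℝ)‖ₑ := hd.variation_eq
  have hnull_of : ∀ A : Set V, MeasurableSet A → μH A = 0 → T.variation A = 0 := by
    intro A hA h0
    rw [hvarW, withDensity_apply _ hA]
    apply setLIntegral_measure_zero
    rw [Measure.restrict_apply hA]
    exact measure_inter_null_of_null_left W h0
  have hskel : T.variation (skeletonV b j ε) = 0 :=
    hnull_of _ (isClosed_skeletonV b).measurableSet
      (euclideanHausdorffMeasure_skeletonV_eq_zero b (Nat.lt_succ_self j))
  have hsptc : T.variation (T.supportᶜ) = 0 := by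
    have := T.variation_sdiff_support
    rwa [TopologicalSpace.Opens.coe_top, ← Set.compl_eq_univ_sdiff] at this
  -- the `(j+1)`-faces meeting the support
  have hfin := finite_faces_meeting b hε hcpt.isBounded (ε := ε)
  set F : Finset (Fin n → ℤ) := hfin.toFinset.filter fun z => faceDim z = j + 1 with hF
  have hFmem : ∀ z, z ∈ F ↔ (faceV b ε z ∩ T.support).Nonempty ∧ faceDim z = j + 1 := fun z => by
    simp [hF, Set.Finite.mem_toFinset, hT]
  have hcover : T.variation (⋃ z ∈ F, faceV b ε z)ᶜ = 0 := by
    refine measure_mono_null (fun x hx => ?_) (measure_union_null hsptc hskel)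
    by_cases hxs : x ∈ T.support
    · right
      obtain ⟨z₀, hz₀, hxz₀⟩ := Set.mem_iUnion₂.1 (skeletonV_subset_iUnion_faceV b (j + 1) (hsupp hxs))
      rcases (Nat.le_succ_iff.1 hz₀) with hle | heq
      · exact skeleton_mono hle (faceV_subset_skeletonV b z₀ hxz₀)
      · exact absurd (Set.mem_iUnion₂.2 ⟨z₀, (hFmem z₀).2 ⟨⟨x, hxz₀, hxs⟩, heq⟩, hxz₀⟩) hx
    · left; exact hxs
  have hTU : T = hTr.restrictSet (⋃ z ∈ F, faceV b ε z)
      (F.measurableSet_biUnion fun z _ => measurableSet_faceV b z) := by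
    conv_lhs => rw [← hTr.restrictSet_univ]
    refine hTr.restrictSet_congr_ae MeasurableSet.univ _ ?_
    exact (ae_eq_univ.2 hcover).symm
  have hsum : T = ∑ z ∈ F, hTr.restrictSet (faceV b ε z) (measurableSet_faceV b z) := by
    rw [← hTr.restrictSet_biUnion_finset F (fun z => faceV b ε z) (fun z => measurableSet_faceV b z)
      fun i _ j _ hij => disjoint_faceV b hij]
    exact hTU
  -- finiteness of the density
  set Fd : V → Multivector V (j + 1) := fun x => (θ₀ x : ℝ) • frameVector (ξ x) with hFd
  have hFint : Integrable Fd (μH.restrict W) := by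
    have hsm : AEStronglyMeasurable Fd (μH.restrict W) := by
      have := hd.2.2.2.1.aestronglyMeasurable
      rwa [show (((⊤ : Opens V) : Set V)) = univ from rfl, Measure.restrict_univ] at this
    refine ⟨hsm, ?_⟩
    have h1 : ∫⁻ x, ‖Fd x‖ₑ ∂(μH.restrict W) = ∫⁻ x in W, ‖(θ₀ x : ℝ)‖ₑ ∂μH := by
      refine lintegral_congr_ae ?_
      filter_upwards [hd.2.2.2.2] with x hx
      rw [hFd]
      simp only
      rw [enorm_smul, ← ofReal_norm (frameVector (ξ x)), norm_frameVector_eq_one hx.1,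
        ENNReal.ofReal_one, mul_one]
    rw [HasFiniteIntegral, h1]
    exact hd.mass_lt_top_iff.1 (hd.mass_lt_top_of_isCompact_support hcpt)
  -- a bound for the support
  obtain ⟨R, hR⟩ : ∃ R, ∀ x ∈ T.support, ‖x‖ ≤ R := hcpt.isBounded.exists_norm_le
  /- face by face -/
  have hface : ∀ z ∈ F, ∃ (p : V) (e : Fin (j + 1) → V) (C : Set (Fin (j + 1) → ℝ))
      (θ : (Fin (j + 1) → ℝ) → ℤ), Orthonormal ℝ e ∧ MeasurableSet C ∧ Bornology.IsBounded C ∧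
      IntegrableOn (fun u => (θ u : ℝ)) C ∧
      ∀ ψ : TestForm (⊤ : Opens V) (j + 1),
        hTr.restrictSet (faceV b ε z) (measurableSet_faceV b z) ψ =
          ∫ u in C, (θ u : ℝ) * ψ (p + ∑ l, u l • e l) e := by
    intro z hz
    obtain ⟨-, hzj⟩ := (hFmem z).1 hz
    -- the plane of the face and an orthonormal frame of its direction space
    set P₀ : Submodule ℝ V := faceDirV b z with hP₀
    set p : V := faceCenter b ε z with hp
    have hdim : Module.finrank ℝ P₀ = j + 1 := (finrank_faceDirV b z).trans hzj
    set ob : OrthonormalBasis (Fin (j + 1)) ℝ P₀ :=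
      (stdOrthonormalBasis ℝ P₀).reindex (finCongr hdim) with hob
    set e : Fin (j + 1) → V := fun l => (ob l : V) with he_def
    have he : Orthonormal ℝ e := (P₀.subtypeₗᵢ.orthonormal_comp_iff).2 ob.orthonormal
    have heP : ∀ l, e l ∈ P₀ := fun l => (ob l).2
    -- the piece of `T` in the face
    set W₁ : Set V := W ∩ faceV b ε z with hW₁
    have hW₁m : MeasurableSet W₁ := hWm.inter (measurableSet_faceV b z)
    have hW₁p : W₁ ⊆ {x | x - p ∈ P₀} := fun x hx => faceV_subset_plane b z hx.2
    have hd₁ : IsRectifiableData (⊤ : Opens V) (j + 1) W₁ θ₀ ξ := hd.inter (measurableSet_faceV b z)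
    have hpiece : hTr.restrictSet (faceV b ε z) (measurableSet_faceV b z) =
        (currentOfIntegration W₁ θ₀ ξ : Current (⊤ : Opens V) (j + 1)) := hd.restrictSet_eq _
    -- `W₁` lies in the range of the chart
    have hrange : W₁ ⊆ range fun u : Fin (j + 1) → ℝ => p + ∑ l, u l • e l := fun x hx => by
      have hxp : x - p ∈ P₀ := hW₁p hx
      refine ⟨fun l => ofLp (ob.repr ⟨x - p, hxp⟩) l, ?_⟩
      have h1 := congrArg (fun y : P₀ => (y : V)) (ob.sum_repr ⟨x - p, hxp⟩)
      simp only [Submodule.coe_sum, Submodule.coe_smul] at h1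
      show p + ∑ l, ofLp (ob.repr ⟨x - p, hxp⟩) l • e l = x
      rw [he_def]
      simp only
      rw [h1]
      abel
    -- alignment of the frame: `θ₀ ξ = η e` with `η ∈ ℤ` a.e. on `W₁`
    set η : V → ℝ := fun x => Fd x (frameCovector e) with hη
    set μ₁ : Measure V := μH.restrict W₁ with hμ₁
    have hFint₁ : Integrable Fd μ₁ :=
      hFint.mono_measure (Measure.restrict_mono inter_subset_left le_rfl)
    have hηint : Integrable η μ₁ :=
      (ContinuousLinearMap.apply ℝ ℝ (frameCovector e)).integrable_comp hFint₁
    have hae : ∀ᵐ x ∂μ₁, Fd x = η x • frameVector e ∧ ∃ m : ℤ, η x = m := by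
      filter_upwards [hd₁.ae_frameVector_eq_or P₀ p hW₁p hdim he heP] with x hx
      have h1 : frameVector e (frameCovector e) = 1 := by
        rw [frameVector_apply, frameCovector_self he]
      rcases hx with hx | hx
      · have hη1 : η x = θ₀ x := by
          simp only [hη, hFd, hx, smul_apply, h1, smul_eq_mul, mul_one]
        refine ⟨?_, θ₀ x, hη1⟩
        rw [hη1]
        show (θ₀ x : ℝ) • frameVector (ξ x) = _
        rw [hx]
      · have hη2 : η x = -(θ₀ x : ℝ) := by
          simp only [hη, hFd, hx, smul_apply, neg_apply, h1, smul_eq_mul, mul_neg, mul_one]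
        refine ⟨?_, -θ₀ x, by rw [hη2, Int.cast_neg]⟩
        rw [hη2]
        show (θ₀ x : ℝ) • frameVector (ξ x) = _
        rw [hx, smul_neg]
        exact (neg_smul _ _).symm
    have happly : ∀ ψ : TestForm (⊤ : Opens V) (j + 1),
        (currentOfIntegration W₁ θ₀ ξ : Current (⊤ : Opens V) (j + 1)) ψ =
          ∫ x in W₁, η x * ψ x e ∂μH := by
      intro ψ
      rw [currentOfIntegration_apply hd₁.2.2.2.1]
      refine integral_congr_ae ?_
      filter_upwards [hae] with x hx
      have : (θ₀ x : ℝ) * ψ x (ξ x) = Fd x (ψ x) := by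
        simp only [hFd, smul_apply, frameVector_apply, smul_eq_mul]
      rw [this, hx.1, smul_apply, frameVector_apply, smul_eq_mul]
    -- the chart data
    set Ψ : (Fin (j + 1) → ℝ) → V := fun u => p + ∑ l, u l • e l with hΨ
    set C : Set (Fin (j + 1) → ℝ) := Ψ ⁻¹' W₁ with hC
    have hCm : MeasurableSet C := (measurableEmbedding_affineFrameChart p he).measurable hW₁m
    have hCbdd : Bornology.IsBounded C := by
      rw [Metric.isBounded_iff_subset_closedBall (0 : Fin (j + 1) → ℝ)]
      refine ⟨dist p 0 + R + dist 0 p, fun u hu => ?_⟩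
      have hxu : Ψ u ∈ T.support := hWK hu.1
      have h1 := (lipschitzWith_frameCoordinates p he).dist_le_mul (Ψ u) p
      rw [NNReal.coe_one, one_mul] at h1
      have h2 : (fun l => ⟪e l, Ψ u - p⟫) = u := frameCoordinates_affineFrameChart p he u
      have h3 : (fun l => ⟪e l, p - p⟫) = (0 : Fin (j + 1) → ℝ) := by
        funext l; simp
      rw [h2, h3] at h1
      rw [mem_closedBall]
      refine h1.trans ?_
      calc dist (Ψ u) p ≤ dist (Ψ u) 0 + dist 0 p := dist_triangle _ _ _
        _ ≤ dist p 0 + R + dist 0 p := by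
          rw [dist_zero_right]
          linarith [hR _ hxu, dist_nonneg (x := p) (y := (0 : V))]
    set θ : (Fin (j + 1) → ℝ) → ℤ := fun u => ⌊η (Ψ u)⌋ with hθ
    have haeC : ∀ᵐ u ∂(volume.restrict C), (θ u : ℝ) = η (Ψ u) := by
      have := ae_affineFrameChart_of_ae p he hW₁m hrange (P := fun x => ∃ m : ℤ, η x = m)
        (hae.mono fun x hx => hx.2)
      filter_upwards [this] with u hu
      obtain ⟨m, hm⟩ := hu
      simp only [hθ]
      rw [show η (p + ∑ l, u l • e l) = η (Ψ u) from rfl] at hm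
      rw [hm, Int.floor_intCast]
    have hηΨ : IntegrableOn (fun u => η (Ψ u)) C :=
      (integrableOn_affineFrameChart_iff p he hW₁m hrange η).1 hηint
    have hθint : IntegrableOn (fun u => (θ u : ℝ)) C :=
      hηΨ.congr_fun_ae (haeC.mono fun u hu => hu.symm)
    refine ⟨p, e, C, θ, he, hCm, hCbdd, hθint, fun ψ => ?_⟩
    rw [hpiece, happly ψ,
      setIntegral_euclideanHausdorff_eq_integral_affineFrameChart p he hW₁m hrange (fun x => η x * ψ x e)]
    refine integral_congr_ae ?_
    filter_upwards [haeC] with u hu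
    rw [hu]
  choose! p e C θ hpe using hface
  refine ⟨F, p, e, C, θ, fun z hz => (hpe z hz).1, fun z hz => (hpe z hz).2.1,
    fun z hz => (hpe z hz).2.2.1, fun z hz => (hpe z hz).2.2.2.1, fun ψ => ?_⟩
  have h := congrArg (fun S : Current (⊤ : Opens V) (j + 1) => S ψ) hsum
  simp only [FunLike.coe_sum, Finset.sum_apply] at h
  rw [h]
  exact Finset.sum_congr rfl fun z hz => (hpe z hz).2.2.2.2 ψ

end Faces

end Literature.Geometry.GeometricMeasureTheory
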